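import Summits.Parity.GeneralizedHardyLittlewood.Theorems.GreenTaoLevelTwoMNTwoBoxRegroup
import Summits.Parity.GeneralizedHardyLittlewood.Theorems.GreenTaoLevelTwoMNTwoQuadrilinearDenominator

/-!
# Route `GreenTaoLevelTwo`, crux `MNTwo` (stmt-Parity-21276), line `birth`, stub `stub_mnVertical`:
# regrouping into four bounded functions and extracting the denominator (GT 2008b §10, Lemma 24)

Steps 7 and 9 of the remaining Lemma-24 assembly for `stub_mnVertical` (B. Green, T. Tao,
*Quadratic uniformity of the Möbius function*, Ann. Inst. Fourier 58 (2008) = arXiv:math/0606087,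
§10: "we may thus find … bounded functions `b(l₂,m₁,m₂), …` … Applying Lemma A.9 three times").
Def-free composition of `…MNTwoBoxRegroup.box_regroup` (the fifteen remaining real cutoffs, the
box indicators `χ₁(l₁,l₂)`, `χ₂(m₁,m₂)` and the character `e(β·P(l₀+l₂+l₁, m₀+m₂+m₁))` regroup into
`b₁(l₂,m₁,m₂) b₂(l₁,m₁,m₂) b₃(l₁,l₂,m₂) b₄(l₁,l₂,m₁)`) with
`…MNTwoQuadrilinearDenominator.quadrilinear_denominator` (box Cauchy–Schwarz and three rounds of
Lemma 32 (ii)) on the boxes `l₁, l₂ ∈ [−L,L]`, `m₁, m₂ ∈ [−M,M]`: a large weighted sum of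
`e(2θ l₁l₂m₁m₂)` (after the Fourier replacement of the sixteenth cutoff) forces a denominator
`q ≤ Q(η)` with `‖q·2θ‖_{ℝ/ℤ} ≤ C(η)/(2L+1)`-type bound; all the `δ`-parameters and largeness
conditions `H1–H6` of `quadrilinear_denominator` are passed through.

* `regrouped_denominator` — the statement just described.

References: [GreenTao2008QuadraticMobius] arXiv:math/0606087 §10 (proof of Lemma 24), App. A.
-/

noncomputable section

open Finset
open scoped FourierTransform

namespace Summit.Parity.GeneralizedHardyLittlewood.GreenTaoLevelTwoMNTwoRegroupedDenominator

open Literature.NumberTheory.Sieve.Vinogradov (distInt)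
open Summit.Parity.GeneralizedHardyLittlewood.GreenTaoLevelTwoMNTwoBoxRegroup (box_regroup)
open Summit.Parity.GeneralizedHardyLittlewood.GreenTaoLevelTwoMNTwoQuadrilinearDenominator
  (quadrilinear_denominator)

/-- **Regrouping and denominator extraction (Lemma 24, steps (b) and Lemma 32 ×3).**  Let
`|wt| ≤ 1`, `|χ₁|, |χ₂| ≤ 1`, `β, θ ∈ ℝ`, `L, M ≥ 1`, `0 < η ≤ 1`, and the `δ`-parameters /
largeness conditions of `…MNTwoQuadrilinearDenominator.quadrilinear_denominator` for the boxes
`[−L,L], [−L,L], [−M,M], [−M,M]`.  If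
`η(2L+1)²(2M+1)² ≤ ‖∑_{l₁,m₁,l₂,m₂} (Π₁₅ wt · χ₁χ₂) e(β P(l₀+l₂+l₁,m₀+m₂+m₁)) e(2θ l₁l₂m₁m₂)‖`
then some `1 ≤ q ≤ (25672/(κ/2)²)(25672/δB²)(25672/δC²)` has
`‖q·(2θ)‖_{ℝ/ℤ} ≤ 2630455808·64·δ₁C/(δC⁶(2L+1))`.
[cite: GreenTao2008QuadraticMobius, §10 (proof of Lemma 24), App. A Lemma 32] -/
theorem regrouped_denominator (wt : ℤ → ℤ → ℝ) (hwt : ∀ l m, |wt l m| ≤ 1)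
    (χ₁ χ₂ : ℤ → ℤ → ℝ) (hχ₁ : ∀ x y, |χ₁ x y| ≤ 1) (hχ₂ : ∀ x y, |χ₂ x y| ≤ 1)
    (β θ : ℝ) (d w s t l₀ m₀ : ℤ) {L M : ℕ}
    {η κ δ₁A δB δ₁B δC δ₁C : ℝ} (hη : 0 < η) (hη1 : η ≤ 1) (hκ : κ = η ^ 16)
    (hδ₁A : δ₁A = 1 / (κ * (((M : ℤ) - (-(M : ℤ)) + 1 : ℤ) : ℝ)))
    (hδB : δB = (κ / 2) ^ 3 / 51344)
    (hδ₁B : δ₁B = 2630455808 * 64 * δ₁A / ((κ / 2) ^ 6 * (((M : ℤ) - (-(M : ℤ)) + 1 : ℤ) : ℝ)))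
    (hδC : δC = δB ^ 3 / 51344)
    (hδ₁C : δ₁C = 2630455808 * 64 * δ₁B / (δB ^ 6 * (((L : ℤ) - (-(L : ℤ)) + 1 : ℤ) : ℝ)))
    (H1 : δ₁A ≤ κ / 16) (H2 : 2 < (κ / 4) ^ 2 * (((M : ℤ) - (-(M : ℤ)) + 1 : ℤ) : ℝ))
    (H3 : δ₁B ≤ δB / 8) (H4 : 2 < (δB / 2) ^ 2 * (((L : ℤ) - (-(L : ℤ)) + 1 : ℤ) : ℝ))
    (H5 : δ₁C ≤ δC / 8) (H6 : 2 < (δC / 2) ^ 2 * (((L : ℤ) - (-(L : ℤ)) + 1 : ℤ) : ℝ))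
    (hlarge : η * (((L : ℤ) - (-(L : ℤ)) + 1 : ℤ) : ℝ) * (((L : ℤ) - (-(L : ℤ)) + 1 : ℤ) : ℝ) *
        (((M : ℤ) - (-(M : ℤ)) + 1 : ℤ) : ℝ) * (((M : ℤ) - (-(M : ℤ)) + 1 : ℤ) : ℝ) ≤
      ‖∑ l₁ ∈ Icc (-(L : ℤ)) L, ∑ m₁ ∈ Icc (-(M : ℤ)) M, ∑ l₂ ∈ Icc (-(L : ℤ)) L,
        ∑ m₂ ∈ Icc (-(M : ℤ)) M,
        (((wt l₀ m₀ * wt l₀ (m₀ + m₁) * wt (l₀ + l₁) m₀ * wt (l₀ + l₁) (m₀ + m₁)) *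
            (wt l₀ (m₀ + m₂) * wt l₀ (m₀ + m₂ + m₁) * wt (l₀ + l₁) (m₀ + m₂) *
              wt (l₀ + l₁) (m₀ + m₂ + m₁)) *
            (wt (l₀ + l₂) m₀ * wt (l₀ + l₂) (m₀ + m₁) * wt (l₀ + l₂ + l₁) m₀ *
              wt (l₀ + l₂ + l₁) (m₀ + m₁)) *
            (wt (l₀ + l₂) (m₀ + m₂) * wt (l₀ + l₂) (m₀ + m₂ + m₁) * wt (l₀ + l₂ + l₁) (m₀ + m₂)) *
            χ₁ l₁ l₂ * χ₂ m₁ m₂ : ℝ) : ℂ) *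
          (𝐞 (β * ((d + s * (l₀ + l₂ + l₁)) * (w + t * (m₀ + m₂ + m₁)) : ℤ)) : ℂ) *
          (𝐞 (2 * θ * l₁ * l₂ * m₁ * m₂) : ℂ)‖) :
    ∃ q : ℕ, 1 ≤ q ∧
      (q : ℝ) ≤ (25672 / (κ / 2) ^ 2) * (25672 / δB ^ 2) * (25672 / δC ^ 2) ∧
      distInt (q * (2 * θ)) ≤
        2630455808 * 64 * δ₁C / (δC ^ 6 * (((L : ℤ) - (-(L : ℤ)) + 1 : ℤ) : ℝ)) := by
  classical
  obtain ⟨b₁, b₂, b₃, b₄, hb₁, hb₂, hb₃, hb₄, hterm⟩ :=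
    box_regroup wt hwt χ₁ χ₂ hχ₁ hχ₂ β d w s t l₀ m₀
  -- rewrite every term and reorder the sums to `l₁, l₂, m₁, m₂`
  have hsum : ∑ l₁ ∈ Icc (-(L : ℤ)) L, ∑ m₁ ∈ Icc (-(M : ℤ)) M, ∑ l₂ ∈ Icc (-(L : ℤ)) L,
        ∑ m₂ ∈ Icc (-(M : ℤ)) M,
        (((wt l₀ m₀ * wt l₀ (m₀ + m₁) * wt (l₀ + l₁) m₀ * wt (l₀ + l₁) (m₀ + m₁)) *
            (wt l₀ (m₀ + m₂) * wt l₀ (m₀ + m₂ + m₁) * wt (l₀ + l₁) (m₀ + m₂) *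
              wt (l₀ + l₁) (m₀ + m₂ + m₁)) *
            (wt (l₀ + l₂) m₀ * wt (l₀ + l₂) (m₀ + m₁) * wt (l₀ + l₂ + l₁) m₀ *
              wt (l₀ + l₂ + l₁) (m₀ + m₁)) *
            (wt (l₀ + l₂) (m₀ + m₂) * wt (l₀ + l₂) (m₀ + m₂ + m₁) * wt (l₀ + l₂ + l₁) (m₀ + m₂)) *
            χ₁ l₁ l₂ * χ₂ m₁ m₂ : ℝ) : ℂ) *
          (𝐞 (β * ((d + s * (l₀ + l₂ + l₁)) * (w + t * (m₀ + m₂ + m₁)) : ℤ)) : ℂ) *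
          (𝐞 (2 * θ * l₁ * l₂ * m₁ * m₂) : ℂ) =
      ∑ l₁ ∈ Icc (-(L : ℤ)) L, ∑ l₂ ∈ Icc (-(L : ℤ)) L, ∑ m₁ ∈ Icc (-(M : ℤ)) M,
        ∑ m₂ ∈ Icc (-(M : ℤ)) M,
          b₁ l₂ m₁ m₂ * b₂ l₁ m₁ m₂ * b₃ l₁ l₂ m₂ * b₄ l₁ l₂ m₁ *
            (𝐞 ((2 * θ) * l₁ * l₂ * m₁ * m₂) : ℂ) := by
    refine Finset.sum_congr rfl fun l₁ _ => ?_
    rw [Finset.sum_comm]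
    refine Finset.sum_congr rfl fun l₂ _ => Finset.sum_congr rfl fun m₁ _ =>
      Finset.sum_congr rfl fun m₂ _ => ?_
    rw [hterm l₁ m₁ l₂ m₂]
  rw [hsum] at hlarge
  exact quadrilinear_denominator (2 * θ) (by omega) (by omega) (by omega) (by omega) b₁ b₂ b₃ b₄
    hb₁ hb₂ hb₃ hb₄ hη hη1 hκ hδ₁A hδB hδ₁B hδC hδ₁C H1 H2 H3 H4 H5 H6 hlarge

end Summit.Parity.GeneralizedHardyLittlewood.GreenTaoLevelTwoMNTwoRegroupedDenominator
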